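import Summits.BirchSwinnertonDyer.BirchSwinnertonDyer.Theorems.ClassRecordThreeEulerHalvesAtThreeCartanCoverPrintClausesDivision
import Summits.BirchSwinnertonDyer.BirchSwinnertonDyer.Theorems.ClassRecordThreeEulerHalvesAtThreeCartanCoverDefs
import Summits.BirchSwinnertonDyer.BirchSwinnertonDyer.Theorems.ClassRecordThreeEulerHalvesAtThreeCartanCoverCocompact
import Literature.NumberTheory.Automorphic.ShimuraCurveDivisionLattice
import HarnessLib

/-!
# Crux NUM `CartanOnePlaceDegreeLawAtThree` (item 24801), line `lattice` v13 — the print clauses (ESᶜ), (SIGᶜ) II: cocompact `ι(O¹)` is finitely generated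
# ((SIGᶜ)(i) holds) and its real period map is injective ((ESᶜ) injectivity holds); the cover groups `ι(O₀'¹)` of a Cartan datum at `D > 1`

Seat `bsd-stepL-tam3-p1` g29 (LEAD of crux 24801; `--supports stmt-BirchSwinnertonDyer-24801 --as helper`). Sequel of `…CartanCoverPrintClausesDivision` (§1 no
parabolic elements ∕ no cusps at a division algebra; §2 (SIGᶜ)(i) ⇐ finite generation). Here:

* §3 (any COCOMPACT `ι(O¹)` acting properly discontinuously — a compact `K ⊆ ℍ` meeting every orbit): `ι(O¹)` is finitely generated (Shimura Prop. 8.6;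
  adapted from the tree file `ShimuraCurvePeriodsHeckeIntegralityProofs`, which has no hub olean in this import closure), so (SIGᶜ)(i) HOLDS
  (`sigBasisClause_of_cocompact`); and the INJECTIVITY HALF OF (ESᶜ) HOLDS (`eq_zero_of_forall_rePeriod_eq_zero_of_cocompact`: a weight-two form all of
  whose real periods `CuspForm.rePeriod F z₀ γ = Re ∫_{z₀}^{γ z₀} F` vanish is zero — maximum principle for `exp ∘ ∫F` on the compact quotient, adapted from the
  same tree file).
* §4 (the instances the line consumes, `D > 1`): for a Cartan datum `X : CartanLevelCurveData D M C` and a place `q`, the COVER GROUP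
  `coverUnits X q = ι(O₀'¹)` (`O₀' = X.O ⊔ (∏_{C∖q} p)•X.O₀`, the binder `hO'` of (JLᶜ)∕(COMMᶜ) by `rfl`) lies between `X.Gamma` and the hull group `ι(O₀¹)`; so it
  acts properly discontinuously (`properlyDiscontinuousSMul_coverUnits`), is COCOMPACT for `D > 1` (`coverUnits_exists_smul_mem_closedBall_of_one_lt`, from the
  tree's `cartanGamma_exists_dist_le_of_one_lt`), hence FINITELY GENERATED (`fg_coverUnits_of_one_lt`), has no parabolic elements and no cusps (`X.B` is a
  division algebra for `D > 1`, tree `ShimuraCurveData.isUnit_of_ne_zero`), satisfies (SIGᶜ)(i) (`sigBasisClause_coverUnits_of_one_lt`) and the INJECTIVITY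
  half of (ESᶜ) (`eq_zero_of_forall_rePeriod_eq_zero_coverUnits`, `exists_rePeriod_ne_zero_coverUnits`) — i.e. at the very instances `(X.B, O₀', X.ι)`, `D > 1`,
  at which bsd-idea-10's kernel glue `CartanCarayol.cuspidalEigenCochainLift_of_facts` consumes (ESᶜ) ∕ (SIGᶜ), their first conjuncts are THEOREMS.

WHAT REMAINS PRINT (honest): (ESᶜ)-SURJECTIVITY (Hodge theory; for `D > 1` reachable in-tree through `Literature.Geometry.Kaehler.RiemannSurface…`
`existsUnique_re_period_eq` once `Γ(3)∖ℍ` is available as a compact Riemann surface with its quotient covering — not done here), (SIGᶜ)(ii) (Armstrong ∕ the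
Fuchsian presentation), and everything at `D = 1` (cusps). Nothing is proved about NUM, 24801, 23422, 19109 or any curve; BSD is proved for no curve.
[cite: ShimuraIATAF1971, Thm. 8.4 p. 234, Prop. 8.6, §9.2 p. 246] [cite: VignerasLNM800, Ch. IV §1 Thm. 1.1]
-/

set_option linter.dupNamespace false
set_option autoImplicit false

noncomputable section

open scoped MatrixGroups ModularForm Pointwise
open UpperHalfPlane Function Set

namespace Summit.BirchSwinnertonDyer.BirchSwinnertonDyer.Theorems.CartanCover.PrintClauses

open Literature.NumberTheory.Automorphic
open Summit.BirchSwinnertonDyer.BirchSwinnertonDyer.Theorems.CartanTransport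

/-! ## §3 Cocompact `ι(O¹)`: finite generation (⇒ (SIGᶜ)(i)) and the injectivity half of (ESᶜ) -/

section Cocompact

variable {Γ : Subgroup (GL (Fin 2) ℝ)}

/-- **A properly discontinuous cocompact `Γ` is finitely generated** (Shimura Prop. 8.6: generated by the finitely many `γ` with `γK' ∩ K' ≠ ∅` for a compact
ball `K' ⊇ K`; the translates of an open ball between `K` and `K'` by the subgroup they generate and by its complement are disjoint open sets covering
the connected `ℍ`).
-- adapted from Literature/NumberTheory/Automorphic/ShimuraCurvePeriodsHeckeIntegralityProofs.lean §1 (that module has no hub olean in this closure)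
[cite: ShimuraIATAF1971, Prop. 8.6 (proof)] -/
private theorem group_fg_of_isCompact_of_forall_exists_smul_mem' [ProperlyDiscontinuousSMul Γ ℍ] {K : Set ℍ} (hK : IsCompact K)
    (hcov : ∀ τ : ℍ, ∃ γ ∈ Γ, γ • τ ∈ K) : Group.FG Γ := by
  classical
  obtain ⟨R, hR0, hR⟩ := hK.isBounded.subset_closedBall_lt 0 UpperHalfPlane.I
  set V : Set ℍ := Metric.ball UpperHalfPlane.I (R + 1) with hV
  set K' : Set ℍ := Metric.closedBall UpperHalfPlane.I (R + 1) with hK'def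
  have hK' : IsCompact K' := isCompact_closedBall _ _
  have hVK' : V ⊆ K' := Metric.ball_subset_closedBall
  have hKV : K ⊆ V := hR.trans (Metric.closedBall_subset_ball (by linarith))
  have hVopen : IsOpen V := Metric.isOpen_ball
  have hIV : UpperHalfPlane.I ∈ V := Metric.mem_ball_self (by linarith)
  set S : Set Γ := {γ : Γ | ((fun x : ℍ => γ • x) '' K' ∩ K').Nonempty} with hSdef
  have hSfin : S.Finite := ProperlyDiscontinuousSMul.finite_disjoint_inter_image hK' hK'
  refine Group.fg_iff.mpr ⟨S, ?_, hSfin⟩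
  set H : Subgroup Γ := Subgroup.closure S with hHdef
  have key : ∀ δ₁ δ₂ : Γ, δ₁ ∈ H →
      (((δ₁ : GL (Fin 2) ℝ) • V) ∩ ((δ₂ : GL (Fin 2) ℝ) • V)).Nonempty → δ₂ ∈ H := by
    rintro δ₁ δ₂ h₁ ⟨x, hx₁, hx₂⟩
    obtain ⟨v₁, hv₁, rfl⟩ := Set.mem_smul_set.mp hx₁
    obtain ⟨v₂, hv₂, he⟩ := Set.mem_smul_set.mp hx₂
    have hmem : δ₁⁻¹ * δ₂ ∈ S := by
      refine ⟨v₁, ⟨v₂, hVK' hv₂, ?_⟩, hVK' hv₁⟩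
      show ((δ₁⁻¹ * δ₂ : Γ) : GL (Fin 2) ℝ) • v₂ = v₁
      rw [Subgroup.coe_mul, Subgroup.coe_inv, mul_smul, he, inv_smul_smul]
    have : δ₁ * (δ₁⁻¹ * δ₂) ∈ H := H.mul_mem h₁ (Subgroup.subset_closure hmem)
    simpa using this
  have hcovV : ∀ τ : ℍ, ∃ δ : Γ, τ ∈ (δ : GL (Fin 2) ℝ) • V := by
    intro τ
    obtain ⟨g, hg, hgτ⟩ := hcov τ
    refine ⟨⟨g, hg⟩⁻¹, Set.mem_smul_set.mpr ⟨g • τ, hKV hgτ, ?_⟩⟩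
    rw [Subgroup.coe_inv, Subgroup.coe_mk, inv_smul_smul]
  set U₁ : Set ℍ := ⋃ δ ∈ {δ : Γ | δ ∈ H}, (δ : GL (Fin 2) ℝ) • V with hU₁
  set U₂ : Set ℍ := ⋃ δ ∈ {δ : Γ | δ ∉ H}, (δ : GL (Fin 2) ℝ) • V with hU₂
  have hU₁o : IsOpen U₁ := isOpen_biUnion fun δ _ => hVopen.smul _
  have hU₂o : IsOpen U₂ := isOpen_biUnion fun δ _ => hVopen.smul _
  have hcover : (Set.univ : Set ℍ) ⊆ U₁ ∪ U₂ := by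
    intro τ _
    obtain ⟨δ, hδ⟩ := hcovV τ
    by_cases h : δ ∈ H
    · exact Or.inl (Set.mem_biUnion (show δ ∈ {δ : Γ | δ ∈ H} from h) hδ)
    · exact Or.inr (Set.mem_biUnion (show δ ∈ {δ : Γ | δ ∉ H} from h) hδ)
  have hdisj : (Set.univ : Set ℍ) ∩ (U₁ ∩ U₂) = ∅ := by
    rw [Set.univ_inter, Set.eq_empty_iff_forall_notMem]
    rintro x ⟨hx₁, hx₂⟩
    simp only [hU₁, hU₂, Set.mem_iUnion, Set.mem_setOf_eq, exists_prop] at hx₁ hx₂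
    obtain ⟨δ₁, hδ₁, hxδ₁⟩ := hx₁
    obtain ⟨δ₂, hδ₂, hxδ₂⟩ := hx₂
    exact hδ₂ (key δ₁ δ₂ hδ₁ ⟨x, hxδ₁, hxδ₂⟩)
  have h1V : UpperHalfPlane.I ∈ ((1 : Γ) : GL (Fin 2) ℝ) • V := by
    rw [Subgroup.coe_one, one_smul]; exact hIV
  rcases (isPreconnected_iff_subset_of_disjoint.mp isPreconnected_univ) U₁ U₂ hU₁o hU₂o hcover
    hdisj with hall | hall
  · rw [eq_top_iff]
    intro γ _
    have hγI : (γ : GL (Fin 2) ℝ) • UpperHalfPlane.I ∈ U₁ := hall (Set.mem_univ _)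
    simp only [hU₁, Set.mem_iUnion, Set.mem_setOf_eq, exists_prop] at hγI
    obtain ⟨δ, hδ, hγδ⟩ := hγI
    exact key δ γ hδ ⟨_, hγδ, Set.smul_mem_smul_set hIV⟩
  · exfalso
    have hI : UpperHalfPlane.I ∈ U₂ := hall (Set.mem_univ _)
    simp only [hU₂, Set.mem_iUnion, Set.mem_setOf_eq, exists_prop] at hI
    obtain ⟨δ, hδ, hIδ⟩ := hI
    exact hδ (key 1 δ H.one_mem ⟨_, h1V, hIδ⟩)

variable [Γ.HasDetOne]

/-- The primitive `Ψ = ∫_{τ₀}^τ F` transforms under `γ ∈ Γ` by the period: `Ψ(γτ) = Ψ(τ) + ∫_{τ₀}^{γτ₀} F` (`Γ`-invariance of segment integrals,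
`segmentIntegral_slash_eq` + `F ∣[2] γ = F`).
-- adapted from Literature/NumberTheory/Automorphic/ShimuraCurvePeriodsHeckeIntegralityProofs.lean §2
[cite: ShimuraIATAF1971, §8.2 (8.2.19)–(8.2.20)] -/
private theorem segmentIntegral_smul_eq_add_period' (F : CuspForm Γ 2) {γ : GL (Fin 2) ℝ} (hγ : γ ∈ Γ) (τ₀ τ : ℍ) :
    segmentIntegral F τ₀ (γ • τ) = segmentIntegral F τ₀ τ + segmentIntegral F τ₀ (γ • τ₀) := by
  have hdet : 0 < γ.det.val := by
    rw [Subgroup.HasDetOne.det_eq hγ, Units.val_one]; exact one_pos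
  have hinv : segmentIntegral F (γ • τ₀) (γ • τ) = segmentIntegral F τ₀ τ := by
    rw [← segmentIntegral_slash_eq F hdet τ₀ τ, SlashInvariantForm.slash_action_eqn F γ hγ]
  have e2 := segmentIntegral_sub_segmentIntegral F τ₀ (γ • τ₀) (γ • τ)
  linear_combination e2 + hinv

/-- **A weight-two form with purely imaginary periods on a cocompact group vanishes** (Shimura Thm. 8.4, injectivity half): `u = Re ∫_{τ₀}^τ F` is
`Γ`-invariant and continuous, so attains its maximum on the compact `K` meeting every orbit; then `|exp ∫F| = exp u` has an interior maximum, `exp ∫F` is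
constant (maximum modulus on the connected open `ℍ ⊆ ℂ`), and `F = (∫F)' = 0`.
-- adapted from Literature/NumberTheory/Automorphic/ShimuraCurvePeriodsHeckeIntegralityProofs.lean §3 (no hub olean for that module in this closure)
[cite: ShimuraIATAF1971, Thm. 8.4] -/
private theorem coe_eq_zero_of_forall_re_period_eq_zero' {K : Set ℍ} (hK : IsCompact K)
    (hcov : ∀ τ : ℍ, ∃ γ ∈ Γ, γ • τ ∈ K) (F : CuspForm Γ 2) (τ₀ : ℍ)
    (H : ∀ γ ∈ Γ, (segmentIntegral F τ₀ (γ • τ₀)).re = 0) : (⇑F : ℍ → ℂ) = 0 := by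
  set Ψ : ℍ → ℂ := segmentIntegral F τ₀ with hΨdef
  have hinv : ∀ γ ∈ Γ, ∀ τ : ℍ, (Ψ (γ • τ)).re = (Ψ τ).re := by
    intro γ hγ τ
    rw [hΨdef, segmentIntegral_smul_eq_add_period' F hγ τ₀ τ, Complex.add_re, H γ hγ, add_zero]
  have hderiv : ∀ z : ℂ, 0 < z.im → HasDerivAt (Ψ ∘ ofComplex) (F (ofComplex z)) z :=
    fun z hz => hasDerivAt_segmentIntegral F τ₀ hz
  have hdiff : DifferentiableOn ℂ (Ψ ∘ ofComplex) {z : ℂ | 0 < z.im} :=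
    differentiableOn_segmentIntegral F τ₀
  have hΨc : Continuous Ψ := by
    have h2 : Ψ = (Ψ ∘ ofComplex) ∘ ((↑) : ℍ → ℂ) := by
      funext τ; simp [ofComplex_apply]
    rw [h2]
    exact hdiff.continuousOn.comp_continuous continuous_coe fun τ => τ.im_pos
  have hKne : K.Nonempty := by
    obtain ⟨γ, -, hγ⟩ := hcov UpperHalfPlane.I
    exact ⟨_, hγ⟩
  obtain ⟨k, hkK, hk⟩ := hK.exists_isMaxOn hKne (Complex.continuous_re.comp hΨc).continuousOn
  have hmax : ∀ τ : ℍ, (Ψ τ).re ≤ (Ψ k).re := by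
    intro τ
    obtain ⟨γ, hγ, hγτ⟩ := hcov τ
    rw [← hinv γ hγ τ]
    exact hk hγτ
  set f : ℂ → ℂ := fun z => Complex.exp ((Ψ ∘ ofComplex) z) with hfdef
  have hfd : DifferentiableOn ℂ f {z : ℂ | 0 < z.im} := hdiff.cexp
  have hkU : (k : ℂ) ∈ {z : ℂ | 0 < z.im} := k.im_pos
  have hfmax : IsMaxOn (norm ∘ f) {z : ℂ | 0 < z.im} (k : ℂ) := by
    intro z hz
    simp only [Function.comp_apply, hfdef, Complex.norm_exp, Set.mem_setOf_eq]
    refine Real.exp_le_exp.mpr ?_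
    rw [ofComplex_apply, ofComplex_apply_of_im_pos hz]
    exact hmax _
  have hconst := Complex.eqOn_of_isPreconnected_of_isMaxOn_norm
    (convex_halfSpace_im_gt 0).isPreconnected isOpen_upperHalfPlaneSet hfd hkU hfmax
  funext τ
  have hτ : 0 < (τ : ℂ).im := τ.im_pos
  have hd1 : HasDerivAt f (Complex.exp ((Ψ ∘ ofComplex) (τ : ℂ)) * F (ofComplex (τ : ℂ))) (τ : ℂ) :=
    (hderiv (τ : ℂ) hτ).cexp
  have hd2 : HasDerivAt f 0 (τ : ℂ) := by
    have hev : f =ᶠ[nhds (τ : ℂ)] fun _ => f (k : ℂ) :=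
      Filter.eventuallyEq_of_mem (isOpen_upperHalfPlaneSet.mem_nhds hτ) hconst
    exact (hasDerivAt_const (τ : ℂ) (f (k : ℂ))).congr_of_eventuallyEq hev
  have h0 := hd1.unique hd2
  rw [ofComplex_apply] at h0
  rcases mul_eq_zero.mp h0 with h1 | h1
  · exact absurd h1 (Complex.exp_ne_zero _)
  · simpa using h1

end Cocompact

section CocompactUnits

variable {B : Type*} [Ring B] [Algebra ℚ B] (ι : B →ₐ[ℚ] Matrix (Fin 2) (Fin 2) ℝ) {O : Submodule ℤ B} (hO : Brandt.IsOrder B O)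

/-- **(SIGᶜ)(i) HOLDS for every properly discontinuous COCOMPACT `ι(O¹)`** (finite generation, Shimura Prop. 8.6, then §2).
[cite: ShimuraIATAF1971, Prop. 8.6] [cite: Iwaniec2002, Ch. 2 Prop. 2.3 and Prop. 2.6] -/
theorem sigBasisClause_of_cocompact [ProperlyDiscontinuousSMul (normOneUnits ι hO) ℍ] {K : Set ℍ} (hK : IsCompact K)
    (hcov : ∀ τ : ℍ, ∃ γ ∈ normOneUnits ι hO, γ • τ ∈ K) :
    ∃ (r : ℕ) (e : Fin r → (normOneUnits ι hO → ℤ)),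
      (∀ i, (∀ γ δ : normOneUnits ι hO, e i (γ * δ) = e i γ + e i δ) ∧
        (∀ γ : normOneUnits ι hO, (γ : GL (Fin 2) ℝ).IsParabolic → e i γ = 0)) ∧
      ∀ u : normOneUnits ι hO → ℤ,
        (∀ γ δ : normOneUnits ι hO, u (γ * δ) = u γ + u δ) →
        (∀ γ : normOneUnits ι hO, (γ : GL (Fin 2) ℝ).IsParabolic → u γ = 0) →
        ∃! c : Fin r → ℤ, u = fun γ => ∑ i, c i * e i γ := by
  haveI : Group.FG (normOneUnits ι hO) := group_fg_of_isCompact_of_forall_exists_smul_mem' hK hcov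
  exact sigBasisClause_of_fg ι hO

/-- **THE INJECTIVITY HALF OF (ESᶜ) HOLDS for every COCOMPACT `ι(O¹)`**: if a compact `K ⊆ ℍ` meets every orbit, a weight-two form all of whose real
periods `Re ∫_{z₀}^{γ z₀} F` vanish is zero — the first conjunct of `eichlerShimura_weightTwo_rePeriod` at `(B, O, ι)`, PROVED in the cocompact case.
[cite: ShimuraIATAF1971, Thm. 8.4 p. 234] -/
theorem eq_zero_of_forall_rePeriod_eq_zero_of_cocompact {K : Set ℍ} (hK : IsCompact K)
    (hcov : ∀ τ : ℍ, ∃ γ ∈ normOneUnits ι hO, γ • τ ∈ K) (z₀ : ℍ) (F : CuspForm (normOneUnits ι hO) 2)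
    (h : ∀ γ : normOneUnits ι hO, CuspForm.rePeriod F z₀ γ = 0) : F = 0 := by
  have h0 := coe_eq_zero_of_forall_re_period_eq_zero' hK hcov F z₀ fun γ hγ => h ⟨γ, hγ⟩
  exact DFunLike.coe_injective (h0.trans CuspForm.coe_zero.symm)

end CocompactUnits

/-! ## §4 The cover groups `ι(O₀'¹)` of a Cartan datum: properly discontinuous; cocompact, finitely generated, parabolic-free for `D > 1`;
(SIGᶜ)(i) and the injectivity half of (ESᶜ) there -/

section Cover

variable {D M : ℕ} {C : Finset ℕ} (X : CartanLevelCurveData D M C) (q : ℕ)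

/-- **`ι(O₀'¹) ≤ ι(O₀¹)`**: the cover group lies in the hull group (`O₀' ≤ O₀`, tree `coverOrder_le`). [folklore] -/
theorem coverUnits_le_hullUnits : coverUnits X q ≤ normOneUnits X.ι X.isEichlerOrder.isOrder :=
  Hull.normOneUnits_mono X.ι (isOrder_coverOrder X q) X.isEichlerOrder.isOrder (coverOrder_le X q)

/-- **The cover group acts properly discontinuously on `ℍ`** (a subgroup of the hull group `ι(O₀¹)`, which does: tree
`ShimuraCurveData.properlyDiscontinuousSMul_Gamma` for the hull datum `X.toShimuraCurveData`). [cite: VignerasLNM800, Ch. IV §1 Thm. 1.1 (1)] -/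
theorem properlyDiscontinuousSMul_coverUnits : ProperlyDiscontinuousSMul (coverUnits X q) ℍ := by
  obtain ⟨fd₀, h₀⟩ := Hull.exists_isHypFundamentalDomain_hull X
  have hH : ProperlyDiscontinuousSMul (X.toShimuraCurveData fd₀ h₀).Gamma ℍ :=
    (X.toShimuraCurveData fd₀ h₀).properlyDiscontinuousSMul_Gamma
  rw [Subgroup.properlyDiscontinuousSMul_iff] at hH ⊢
  intro K L hK hL
  refine (hH hK hL).subset ?_
  rintro γ ⟨hγ, hKL⟩
  exact ⟨coverUnits_le_hullUnits X q hγ, hKL⟩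

/-- **The cover group is cocompact for `D > 1`**: one closed hyperbolic ball meets every `ι(O₀'¹)`-orbit (it already meets every orbit of the subgroup
`X.Gamma`, tree `cartanGamma_exists_dist_le_of_one_lt`). [cite: VignerasLNM800, Ch. IV §1 Thm. 1.1] -/
theorem coverUnits_exists_smul_mem_closedBall_of_one_lt (hD : 1 < D) :
    ∃ ρ : ℝ, ∀ z : ℍ, ∃ γ ∈ coverUnits X q, γ • z ∈ Metric.closedBall UpperHalfPlane.I ρ := by
  obtain ⟨ρ, hρ⟩ := MapDegree.cartanGamma_exists_dist_le_of_one_lt X hD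
  refine ⟨ρ, fun z => ?_⟩
  obtain ⟨γ, hγ, h⟩ := hρ z
  exact ⟨γ, Gamma_le_coverUnits X q hγ, Metric.mem_closedBall.mpr h⟩

/-- **The cover group is finitely generated for `D > 1`** (properly discontinuous + cocompact; Shimura Prop. 8.6). [cite: ShimuraIATAF1971, Prop. 8.6] -/
theorem fg_coverUnits_of_one_lt (hD : 1 < D) : Group.FG (coverUnits X q) := by
  haveI := properlyDiscontinuousSMul_coverUnits X q
  obtain ⟨ρ, hρ⟩ := coverUnits_exists_smul_mem_closedBall_of_one_lt X q hD
  exact group_fg_of_isCompact_of_forall_exists_smul_mem' (isCompact_closedBall _ _) hρ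

/-- **`X.B` is a division algebra for `D > 1`** (tree `ShimuraCurveData.isUnit_of_ne_zero` for the hull datum `X.toShimuraCurveData`, whose algebra is `X.B`
definitionally; kept `private` — it is that theorem read through the hull datum). [cite: VignerasLNM800, Ch. III §3] -/
private theorem isUnit_of_ne_zero_of_one_lt (hD : 1 < D) (x : X.B) (hx : x ≠ 0) : IsUnit x := by
  obtain ⟨fd₀, h₀⟩ := Hull.exists_isHypFundamentalDomain_hull X
  exact (X.toShimuraCurveData fd₀ h₀).isUnit_of_ne_zero hD x hx

/-- **No parabolic elements in the cover group for `D > 1`.** [cite: ShimuraIATAF1971, §9.2 p. 246] -/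
theorem not_isParabolic_of_mem_coverUnits_of_one_lt (hD : 1 < D) {γ : GL (Fin 2) ℝ} (hγ : γ ∈ coverUnits X q) : ¬ γ.IsParabolic :=
  not_isParabolic_of_mem_normOneUnits X.ι (isOrder_coverOrder X q) X.ι_injective (isUnit_of_ne_zero_of_one_lt X hD) hγ

/-- **No cusps for the cover group for `D > 1`** (so `CuspForm (coverUnits X q) 2` carries no cusp condition). [cite: ShimuraIATAF1971, §9.2 p. 246] -/
theorem not_isCusp_coverUnits_of_one_lt (hD : 1 < D) (c : OnePoint ℝ) : ¬ IsCusp c (coverUnits X q) :=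
  not_isCusp_normOneUnits X.ι (isOrder_coverOrder X q) X.ι_injective (isUnit_of_ne_zero_of_one_lt X hD) c

/-- **(SIGᶜ)(i) HOLDS for the cover group, `D > 1`**: the additive parabolic-null maps `ι(O₀'¹) → ℤ` have a finite `ℤ`-basis — the first conjunct of
`parabolicCochain_free_and_modLift` at `(X.B, O₀', X.ι)`, PROVED. [cite: Iwaniec2002, Ch. 2 Prop. 2.3 and Prop. 2.6] -/
theorem sigBasisClause_coverUnits_of_one_lt (hD : 1 < D) :
    ∃ (r : ℕ) (e : Fin r → (coverUnits X q → ℤ)),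
      (∀ i, (∀ γ δ : coverUnits X q, e i (γ * δ) = e i γ + e i δ) ∧
        (∀ γ : coverUnits X q, (γ : GL (Fin 2) ℝ).IsParabolic → e i γ = 0)) ∧
      ∀ u : coverUnits X q → ℤ,
        (∀ γ δ : coverUnits X q, u (γ * δ) = u γ + u δ) →
        (∀ γ : coverUnits X q, (γ : GL (Fin 2) ℝ).IsParabolic → u γ = 0) →
        ∃! c : Fin r → ℤ, u = fun γ => ∑ i, c i * e i γ := by
  haveI : Group.FG (normOneUnits X.ι (isOrder_coverOrder X q)) := fg_coverUnits_of_one_lt X q hD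
  exact sigBasisClause_of_fg X.ι (isOrder_coverOrder X q)

/-- **THE INJECTIVITY HALF OF (ESᶜ) HOLDS for the cover group, `D > 1`**: a weight-two form on `ι(O₀'¹)` all of whose real periods vanish is zero — the first
conjunct of `eichlerShimura_weightTwo_rePeriod` at `(X.B, O₀', X.ι)`, PROVED. [cite: ShimuraIATAF1971, Thm. 8.4 p. 234] -/
theorem eq_zero_of_forall_rePeriod_eq_zero_coverUnits (hD : 1 < D) (z₀ : ℍ) (F : CuspForm (coverUnits X q) 2)
    (h : ∀ γ : coverUnits X q, CuspForm.rePeriod F z₀ γ = 0) : F = 0 := by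
  obtain ⟨ρ, hρ⟩ := coverUnits_exists_smul_mem_closedBall_of_one_lt X q hD
  exact eq_zero_of_forall_rePeriod_eq_zero_of_cocompact X.ι (isOrder_coverOrder X q) (isCompact_closedBall _ _) hρ z₀ F h

/-- **A non-zero weight-two form on the cover group (`D > 1`) has a non-zero real period.** [cite: ShimuraIATAF1971, Thm. 8.4 p. 234] -/
theorem exists_rePeriod_ne_zero_coverUnits (hD : 1 < D) (z₀ : ℍ) (F : CuspForm (coverUnits X q) 2) (hF : F ≠ 0) :
    ∃ γ : coverUnits X q, CuspForm.rePeriod F z₀ γ ≠ 0 := by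
  by_contra hc
  push Not at hc
  exact hF (eq_zero_of_forall_rePeriod_eq_zero_coverUnits X q hD z₀ F hc)

end Cover

end Summit.BirchSwinnertonDyer.BirchSwinnertonDyer.Theorems.CartanCover.PrintClauses

end
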